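import Summits.ValiantsHypothesis.ValiantsHypothesis.Theorems.LacunarySymmetroidMatrixDescartesChainBlockM2K5T14
import Summits.ValiantsHypothesis.ValiantsHypothesis.Theorems.LacunarySymmetroidMatrixDescartesChainBlockM2K6G18
import Summits.ValiantsHypothesis.ValiantsHypothesis.Theorems.LacunarySymmetroidMatrixDescartesChainBlockM2K7C22
import Summits.ValiantsHypothesis.ValiantsHypothesis.Theorems.LacunarySymmetroidMatrixDescartesChainBlockM2K8G25

/-!
# `MatrixDescartes` census — MIXED CHAINS of the record blocks at `m = 2`: (2,10) ≥ 32, (2,12) ≥ 39, (2,14) ≥ 47, (2,17) ≥ 57, (2,18) ≥ 61, (2,20) ≥ 69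

HONEST FRAMING.  Object-search cell `pub-symmetroid`, crux `Theses.LacunarySymmetroid.MatrixDescartes`
(stmt-ValiantsHypothesis-18050); seat val-sym-mdr-p1 (g8).  LOWER-bound rows in census (CONJECTURE-A) currency; nothing about the crux
`MatrixDescartes` (upper bound at fat formats), `DoorA26` / `DoorA34`, or `VP ≠ VNP`.  No definitions.

The JUNCTION LAW FOR MATCHING JUNCTION INERTIA (`Chain.chain_append`, files `…ChainInertia.lean`, `…ChainBlocks.lean`) chains DIFFERENT census
certificates whenever the top letter of the chain and the bottom letter of the next block have the same inertia up to sign (Sylvester forms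
`diagonal (±1, …)` recorded in the block files `…ChainBlock<X>.lean`; a block scaled by `−1` flips both of its forms).  At `m = 3` every record
end letter is nonsingular and indefinite except the definite top of `F35`, at `m = 2` the definite family (`T14`, `G18`, the bottoms of `G25`, `T27`,
`T29`) and the indefinite family (`C22`, the tops of `G25`, `T27`, `T29`) chain within themselves.  Each row below adds the alternation counts
of its blocks (`K = 1 + Σ (K_block − 1)` letters); all exceed the self-chain / ladder rays of the same format.  [folklore]
-/

-- `Summit.ValiantsHypothesis.ValiantsHypothesis.…` repeats a component by the D-0017 layout
-- (single-conjunct summit), which the `dupNamespace` linter flags; the name is mandated.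
set_option linter.dupNamespace false

namespace Summit.ValiantsHypothesis.ValiantsHypothesis.Theorems.LacunarySymmetroidMatrixDescartes.Census.Chain.MixM2

open Summit.ValiantsHypothesis.ValiantsHypothesis.Theorems.MatrixDescartes.Negative (PosRootLawAt)
open scoped BigOperators Matrix

/-- **`ζ_sym(2,10) ≥ 32`** — the mixed chain `M2K5T14 ▹ M2K6G18⁻` (junction law for matching junction inertia; `⁻` = block scaled by `−1`). [folklore] -/
theorem mix_2_10 : ¬ PosRootLawAt 2 10 31 := by
  have h := Summit.ValiantsHypothesis.ValiantsHypothesis.Theorems.LacunarySymmetroidMatrixDescartes.Census.Chain.not_posRootLawAt_of_certificateT (by norm_num)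
    (Summit.ValiantsHypothesis.ValiantsHypothesis.Theorems.LacunarySymmetroidMatrixDescartes.Census.Chain.chain_append (by norm_num) (Summit.ValiantsHypothesis.ValiantsHypothesis.Theorems.LacunarySymmetroidMatrixDescartes.Census.Chain.chain_of_block Summit.ValiantsHypothesis.ValiantsHypothesis.Theorems.LacunarySymmetroidMatrixDescartes.Census.Chain.BlockM2K5T14.block)
      (Summit.ValiantsHypothesis.ValiantsHypothesis.Theorems.LacunarySymmetroidMatrixDescartes.Census.Chain.block_smul Summit.ValiantsHypothesis.ValiantsHypothesis.Theorems.LacunarySymmetroidMatrixDescartes.Census.Chain.BlockM2K6G18.block (-1) (by norm_num))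
      (Equiv.refl (Fin 2)) (by intro i; fin_cases i <;> norm_num))
  norm_num at h
  exact h

/-- **`ζ_sym(2,12) ≥ 39`** — the mixed chain `M2K5T14 ▹ M2K8G25⁻` (junction law for matching junction inertia; `⁻` = block scaled by `−1`). [folklore] -/
theorem mix_2_12 : ¬ PosRootLawAt 2 12 38 := by
  have h := Summit.ValiantsHypothesis.ValiantsHypothesis.Theorems.LacunarySymmetroidMatrixDescartes.Census.Chain.not_posRootLawAt_of_certificateT (by norm_num)
    (Summit.ValiantsHypothesis.ValiantsHypothesis.Theorems.LacunarySymmetroidMatrixDescartes.Census.Chain.chain_append (by norm_num) (Summit.ValiantsHypothesis.ValiantsHypothesis.Theorems.LacunarySymmetroidMatrixDescartes.Census.Chain.chain_of_block Summit.ValiantsHypothesis.ValiantsHypothesis.Theorems.LacunarySymmetroidMatrixDescartes.Census.Chain.BlockM2K5T14.block)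
      (Summit.ValiantsHypothesis.ValiantsHypothesis.Theorems.LacunarySymmetroidMatrixDescartes.Census.Chain.block_smul Summit.ValiantsHypothesis.ValiantsHypothesis.Theorems.LacunarySymmetroidMatrixDescartes.Census.Chain.BlockM2K8G25.block (-1) (by norm_num))
      (Equiv.refl (Fin 2)) (by intro i; fin_cases i <;> norm_num))
  norm_num at h
  exact h

/-- **`ζ_sym(2,14) ≥ 47`** — the mixed chain `M2K8G25 ▹ M2K7C22` (junction law for matching junction inertia; `⁻` = block scaled by `−1`). [folklore] -/
theorem mix_2_14 : ¬ PosRootLawAt 2 14 46 := by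
  have h := Summit.ValiantsHypothesis.ValiantsHypothesis.Theorems.LacunarySymmetroidMatrixDescartes.Census.Chain.not_posRootLawAt_of_certificateT (by norm_num)
    (Summit.ValiantsHypothesis.ValiantsHypothesis.Theorems.LacunarySymmetroidMatrixDescartes.Census.Chain.chain_append (by norm_num) (Summit.ValiantsHypothesis.ValiantsHypothesis.Theorems.LacunarySymmetroidMatrixDescartes.Census.Chain.chain_of_block Summit.ValiantsHypothesis.ValiantsHypothesis.Theorems.LacunarySymmetroidMatrixDescartes.Census.Chain.BlockM2K8G25.block)
      Summit.ValiantsHypothesis.ValiantsHypothesis.Theorems.LacunarySymmetroidMatrixDescartes.Census.Chain.BlockM2K7C22.block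
      (Equiv.swap (0 : Fin 2) 1) (by intro i; fin_cases i <;> norm_num [Equiv.swap_apply_left, Equiv.swap_apply_right]))
  norm_num at h
  exact h

/-- **`ζ_sym(2,17) ≥ 57`** — the mixed chain `M2K5T14 ▹ M2K6G18⁻ ▹ M2K8G25⁻` (junction law for matching junction inertia; `⁻` = block scaled by `−1`). [folklore] -/
theorem mix_2_17 : ¬ PosRootLawAt 2 17 56 := by
  have h := Summit.ValiantsHypothesis.ValiantsHypothesis.Theorems.LacunarySymmetroidMatrixDescartes.Census.Chain.not_posRootLawAt_of_certificateT (by norm_num)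
    (Summit.ValiantsHypothesis.ValiantsHypothesis.Theorems.LacunarySymmetroidMatrixDescartes.Census.Chain.chain_append (by norm_num) (Summit.ValiantsHypothesis.ValiantsHypothesis.Theorems.LacunarySymmetroidMatrixDescartes.Census.Chain.chain_append (by norm_num) (Summit.ValiantsHypothesis.ValiantsHypothesis.Theorems.LacunarySymmetroidMatrixDescartes.Census.Chain.chain_of_block Summit.ValiantsHypothesis.ValiantsHypothesis.Theorems.LacunarySymmetroidMatrixDescartes.Census.Chain.BlockM2K5T14.block)
      (Summit.ValiantsHypothesis.ValiantsHypothesis.Theorems.LacunarySymmetroidMatrixDescartes.Census.Chain.block_smul Summit.ValiantsHypothesis.ValiantsHypothesis.Theorems.LacunarySymmetroidMatrixDescartes.Census.Chain.BlockM2K6G18.block (-1) (by norm_num))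
      (Equiv.refl (Fin 2)) (by intro i; fin_cases i <;> norm_num))
      (Summit.ValiantsHypothesis.ValiantsHypothesis.Theorems.LacunarySymmetroidMatrixDescartes.Census.Chain.block_smul Summit.ValiantsHypothesis.ValiantsHypothesis.Theorems.LacunarySymmetroidMatrixDescartes.Census.Chain.BlockM2K8G25.block (-1) (by norm_num))
      (Equiv.refl (Fin 2)) (by intro i; fin_cases i <;> norm_num))
  norm_num at h
  exact h

/-- **`ζ_sym(2,18) ≥ 61`** — the mixed chain `M2K6G18 ▹ M2K6G18 ▹ M2K8G25` (junction law for matching junction inertia; `⁻` = block scaled by `−1`). [folklore] -/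
theorem mix_2_18 : ¬ PosRootLawAt 2 18 60 := by
  have h := Summit.ValiantsHypothesis.ValiantsHypothesis.Theorems.LacunarySymmetroidMatrixDescartes.Census.Chain.not_posRootLawAt_of_certificateT (by norm_num)
    (Summit.ValiantsHypothesis.ValiantsHypothesis.Theorems.LacunarySymmetroidMatrixDescartes.Census.Chain.chain_append (by norm_num) (Summit.ValiantsHypothesis.ValiantsHypothesis.Theorems.LacunarySymmetroidMatrixDescartes.Census.Chain.chain_append (by norm_num) (Summit.ValiantsHypothesis.ValiantsHypothesis.Theorems.LacunarySymmetroidMatrixDescartes.Census.Chain.chain_of_block Summit.ValiantsHypothesis.ValiantsHypothesis.Theorems.LacunarySymmetroidMatrixDescartes.Census.Chain.BlockM2K6G18.block)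
      Summit.ValiantsHypothesis.ValiantsHypothesis.Theorems.LacunarySymmetroidMatrixDescartes.Census.Chain.BlockM2K6G18.block
      (Equiv.refl (Fin 2)) (by intro i; fin_cases i <;> norm_num))
      Summit.ValiantsHypothesis.ValiantsHypothesis.Theorems.LacunarySymmetroidMatrixDescartes.Census.Chain.BlockM2K8G25.block
      (Equiv.refl (Fin 2)) (by intro i; fin_cases i <;> norm_num))
  norm_num at h
  exact h

/-- **`ζ_sym(2,20) ≥ 69`** — the mixed chain `M2K8G25 ▹ M2K7C22 ▹ M2K7C22` (junction law for matching junction inertia; `⁻` = block scaled by `−1`). [folklore] -/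
theorem mix_2_20 : ¬ PosRootLawAt 2 20 68 := by
  have h := Summit.ValiantsHypothesis.ValiantsHypothesis.Theorems.LacunarySymmetroidMatrixDescartes.Census.Chain.not_posRootLawAt_of_certificateT (by norm_num)
    (Summit.ValiantsHypothesis.ValiantsHypothesis.Theorems.LacunarySymmetroidMatrixDescartes.Census.Chain.chain_append (by norm_num) (Summit.ValiantsHypothesis.ValiantsHypothesis.Theorems.LacunarySymmetroidMatrixDescartes.Census.Chain.chain_append (by norm_num) (Summit.ValiantsHypothesis.ValiantsHypothesis.Theorems.LacunarySymmetroidMatrixDescartes.Census.Chain.chain_of_block Summit.ValiantsHypothesis.ValiantsHypothesis.Theorems.LacunarySymmetroidMatrixDescartes.Census.Chain.BlockM2K8G25.block)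
      Summit.ValiantsHypothesis.ValiantsHypothesis.Theorems.LacunarySymmetroidMatrixDescartes.Census.Chain.BlockM2K7C22.block
      (Equiv.swap (0 : Fin 2) 1) (by intro i; fin_cases i <;> norm_num [Equiv.swap_apply_left, Equiv.swap_apply_right]))
      Summit.ValiantsHypothesis.ValiantsHypothesis.Theorems.LacunarySymmetroidMatrixDescartes.Census.Chain.BlockM2K7C22.block
      (Equiv.refl (Fin 2)) (by intro i; fin_cases i <;> norm_num))
  norm_num at h
  exact h

end Summit.ValiantsHypothesis.ValiantsHypothesis.Theorems.LacunarySymmetroidMatrixDescartes.Census.Chain.MixM2
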